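import Mathlib
import Summits.NavierStokesRegularity.NavierStokesRegularity.Theses.HalfSpaceWindowDoor
import Summits.NavierStokesRegularity.NavierStokesRegularity.Theorems.ImplosionDoorImplosionZoomFading
import Summits.NavierStokesRegularity.NavierStokesRegularity.Theorems.LocalSineTubeDoorLocalPointZoomSlices
import Summits.NavierStokesRegularity.NavierStokesRegularity.Theorems.LocalSineTubeDoorProfileAlignedWindowRigidityAncient
import Literature.Analysis.FluidPDE.TypeIAncientMild
import Literature.Analysis.FluidPDE.MildSolution
import Literature.Analysis.FluidPDE.TaoEnstrophyLocalisation
import HarnessLib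

/-!
# `HalfSpaceWindowDoor.HalfSpaceZoom` — local point zoom with closed-hemisphere slices
  (item stmt-NavierStokesRegularity-25312)

**Statement (verbatim route decl).** Under the frame and local Type-I hypotheses of the door's
`Target`, all-window mean-square fading of the negative part of the scale-critical `e`-vorticity,
`∫_{B_R} (min(⟪(T−t) ω(t, x₀ + √(T−t) y), e⟫, 0))² dy → 0` as `t → T⁻` for every `R > 0`, and
failure of backward boundedness at `(x₀, T)` yield `C` and a profile `v` of the Type-I ancient
Oseen-mild class, backward singular at the apex, with `⟪curl v(s,y), e⟫ ≥ 0` for all `s < 0`, `y`.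

PROOF (the item's plan). The PROVED local point zoom with vorticity slices
(`LocalSineTubeDoorLocalPointZoomSlices.localPointZoomSlices`, = PoloidalWindowDoor item 19709)
gives `C, v, λ_j → 0⁺` with `(λ_j²/ν) ω(T + λ_j²s/ν, x₀ + λ_j y) → curl v(s, y)` for every `s < 0`
and `y`. Fix `s < 0`, put `t_j = T + λ_j² s/ν → T⁻` and `c = √(−s/ν)` (`√(T − t_j) = λ_j c`,
`T − t_j = (−s)·λ_j²/ν`): the door functional at time `t_j` and similarity point `y'` is
`F_j(y') = ⟪(−s)·(λ_j²/ν) ω(t_j, x₀ + λ_j (c y')), e⟫ → g(y') = ⟪(−s) curl v(s)(c y'), e⟫`,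
continuous in `y'` (slices of the class are smooth by joint analyticity), while the door hypothesis
along `t_j` says `∫_{B_R} (min(F_j, 0))² → 0`. The fading lemma
(`ZoomFading.nonneg_of_fading_negPart`: Fatou + continuity) gives `g ≥ 0`, i.e.
`⟪curl v(s)(y), e⟫ ≥ 0` at `y = c y'`.

HONEST FRAMING: a compactness/bookkeeping lemma about a HYPOTHETICAL locally Type-I blow-up
(support item of a door route); nothing here bears on Navier–Stokes regularity.
-/

noncomputable section

set_option linter.dupNamespace false

namespace Summit.NavierStokesRegularity.NavierStokesRegularity.Theorems

open MeasureTheory Set Filter Topology Metric Function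
open Literature.Analysis Literature.Analysis.FluidPDE
open scoped RealInnerProductSpace InnerProductSpace ENNReal

open LocalSineTubeDoorLocalPointZoomSlices ZoomFading
  Summit.NavierStokesRegularity.NavierStokesRegularity.Theorems.LocalSineTubeDoorProfileAlignedWindowRigidityAncient in
/-- **Item stmt-NavierStokesRegularity-25312** (`HalfSpaceWindowDoor.HalfSpaceZoom`): at a locally
Type-I, not backward bounded point whose scale-critical `e`-vorticity has fading negative part on
every window, the local point zoom limit is a Type-I ancient Oseen-mild profile, backward singular
at the apex, with closed-hemisphere slices `⟪curl v(s,y), e⟫ ≥ 0`.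
[cite: AlbrittonBarker2019, §2; KochNadirashviliSereginSverak2009, §5–6] -/
theorem halfSpaceWindowDoor_halfSpaceZoom_proof :
    Summit.NavierStokesRegularity.NavierStokesRegularity.Theses.HalfSpaceWindowDoor.HalfSpaceZoom := by
  unfold Summit.NavierStokesRegularity.NavierStokesRegularity.Theses.HalfSpaceWindowDoor.HalfSpaceZoom
  intro ν T hν hT u p hsol hLH hdec x₀ ρ M hρ hM e _he hfade hnotbd
  obtain ⟨C, v, lam, hlam, hlam0, hclass, hsing, hzoom⟩ :=
    localPointZoomSlices ν T hν hT u p hsol hLH hdec x₀ ρ M hρ hM hnotbd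
  refine ⟨C, v, hclass, hsing, fun s hs y => ?_⟩
  obtain ⟨hrate, hcont, hmild, hdiv⟩ := hclass
  -- the class is the tree's `IsTypeIAncientMild` (joint smoothness from joint analyticity),
  -- so the vorticity slice `curl v(s)` is continuous
  have hA : IsTypeIAncientMild C v := by
    refine ⟨(analyticOnNhd_uncurry hcont (bdd_of_hasTypeITimeDecay hrate) hmild).contDiffOn_of_completeSpace,
      fun t ht => hdiv t ht, fun s t hst ht x => ?_, hrate⟩
    rw [heatFlow_of_pos _ (sub_pos.2 hst)]
    exact hmild s t hst ht x
  have hcurlv : Continuous (curl (v s)) := by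
    have h1 : ContDiff ℝ 1 (v s) := (hA.contDiff_slice hs).of_le (by exact_mod_cast le_top)
    rw [curl_eq_curlCLM_comp]
    exact curlCLM.continuous.comp (h1.continuous_fderiv one_ne_zero)
  -- the similarity factor `c = √(−s/ν)` and the zoom times `t_j = T + λ_j² s/ν → T⁻`
  have hsν : 0 < -s / ν := div_pos (neg_pos.2 hs) hν
  set c : ℝ := Real.sqrt (-s / ν) with hcdef
  have hc : 0 < c := Real.sqrt_pos.2 hsν
  set tj : ℕ → ℝ := fun j => T + lam j ^ 2 * s / ν with htjdef
  have htjT : ∀ j, tj j < T := fun j => by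
    have : lam j ^ 2 * s / ν < 0 :=
      div_neg_of_neg_of_pos (mul_neg_of_pos_of_neg (pow_pos (hlam j) 2) hs) hν
    simp only [htjdef]; linarith
  have htj_sub : ∀ j, T - tj j = lam j ^ 2 * (-s / ν) := fun j => by
    simp only [htjdef]; ring
  have hsqrt : ∀ j, Real.sqrt (T - tj j) = lam j * c := fun j => by
    rw [htj_sub, Real.sqrt_mul (sq_nonneg _), Real.sqrt_sq (hlam j).le]
  have htj_nhds : Tendsto tj atTop (𝓝 T) := by
    have h1 : Tendsto (fun j => T + lam j ^ 2 * s / ν) atTop (𝓝 (T + 0 ^ 2 * s / ν)) :=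
      (((hlam0.pow 2).mul_const s).div_const ν).const_add T
    simpa using h1
  have htj_tend : Tendsto tj atTop (𝓝[<] T) :=
    tendsto_nhdsWithin_iff.2 ⟨htj_nhds, Eventually.of_forall htjT⟩
  -- eventually the zoom times are physical: `t_j ∈ [0, T)`
  obtain ⟨N, hN⟩ : ∃ N : ℕ, ∀ j ≥ N, 0 ≤ tj j := by
    obtain ⟨N, hN⟩ := eventually_atTop.1 (htj_nhds.eventually (lt_mem_nhds hT))
    exact ⟨N, fun j hj => (hN j hj).le⟩
  have htjI : ∀ j, tj (j + N) ∈ Ico 0 T := fun j =>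
    ⟨hN _ (Nat.le_add_left N j), htjT _⟩
  -- the door functionals along the (shifted) zoom times and their pointwise limit
  set F : ℕ → EuclideanSpace ℝ (Fin 3) → ℝ := fun j y' =>
    ⟪(T - tj (j + N)) • curl (u (tj (j + N))) (x₀ + Real.sqrt (T - tj (j + N)) • y'), e⟫_ℝ
    with hFdef
  set g : EuclideanSpace ℝ (Fin 3) → ℝ := fun y' => ⟪(-s) • curl (v s) (c • y'), e⟫_ℝ with hgdef
  have hg : Continuous g := by
    have h1 : Continuous fun y' : EuclideanSpace ℝ (Fin 3) => c • y' := continuous_const_smul c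
    have h2 : Continuous fun y' : EuclideanSpace ℝ (Fin 3) => curl (v s) (c • y') := hcurlv.comp h1
    exact (h2.const_smul (-s)).inner continuous_const
  have hF : ∀ j, Measurable (F j) := by
    intro j
    have huC : ContDiff ℝ 1 (u (tj (j + N))) :=
      (hsol.contDiff_velocity (htjI j)).of_le (by exact_mod_cast le_top)
    have huc : Continuous (curl (u (tj (j + N)))) := by
      rw [curl_eq_curlCLM_comp]
      exact curlCLM.continuous.comp (huC.continuous_fderiv one_ne_zero)
    have h1 : Continuous fun y' : EuclideanSpace ℝ (Fin 3) =>
        x₀ + Real.sqrt (T - tj (j + N)) • y' :=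
      continuous_const.add (continuous_const_smul _)
    exact (((huc.comp h1).const_smul (T - tj (j + N))).inner continuous_const).measurable
  have hlimF : ∀ y', Tendsto (fun j => F j y') atTop (𝓝 (g y')) := by
    intro y'
    -- the vorticity zoom at the point `c • y'`, shifted by `N`, scaled by `−s`, paired with `e`
    have hz := ((hzoom s hs (c • y')).comp (tendsto_add_atTop_nat N)).const_smul (-s)
    have hz' := hz.inner (𝕜 := ℝ) (tendsto_const_nhds (x := e))
    refine hz'.congr fun j => ?_
    simp only [hFdef, Function.comp_apply]
    congr 1
    rw [hsqrt, smul_smul, mul_smul (lam (j + N)) c y', htj_sub]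
    congr 1
    field_simp
  have hfadeF : ∀ R : ℝ, 0 < R → Tendsto (fun j => ∫⁻ y' in ball (0 : EuclideanSpace ℝ (Fin 3)) R,
      ENNReal.ofReal ((min (F j y') 0) ^ 2)) atTop (𝓝 0) := by
    intro R hR
    exact ((hfade R hR).comp htj_tend).comp (tendsto_add_atTop_nat N)
  -- the fading lemma: `g ≥ 0`; read it at `y' = c⁻¹ • y`
  have hgy := nonneg_of_fading_negPart hg hF hlimF hfadeF (c⁻¹ • y)
  have hcy : c • c⁻¹ • y = y := by rw [smul_smul, mul_inv_cancel₀ hc.ne', one_smul]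
  simp only [hgdef, hcy, real_inner_smul_left] at hgy
  exact (mul_nonneg_iff_of_pos_left (neg_pos.2 hs)).1 hgy

end Summit.NavierStokesRegularity.NavierStokesRegularity.Theorems

end
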